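import Summits.BirchSwinnertonDyer.BirchSwinnertonDyer.Theorems.InertBadSignedBranchesInertBadAtThreeBedManinIstar
import Summits.BirchSwinnertonDyer.Rank1Residual.X12.InertBadLocalTypesThree
import HarnessLib

/-!
# Manin at a CM-inert bad `3` (line `bed_at_three`, stub `stub_maninAtThree` = R₃): the `Iₙ*` cell is
# CLOSED in the tree, the residual is the QUARTIC cell `j = 1728`, Kodaira `III / III*` at `3`

Crux `InertBadAtThree` (stmt-BirchSwinnertonDyer-19225, routes `InertBadSignedBranches` r4 /
`BiquadraticEisensteinDescent` r5), line `bed_at_three` (ideator bsd-idea-18 g3; lead `bsd-line-ibd-p1`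
g4; skeleton `Cruxes/InertBadAtThree/Lines/bed_at_three.lean` fb44234c142785a0), registered stub
`stub_maninAtThree : ManinAtThree` — route BED's Manin residual `ManinDatumFiveSevenCMInert` (R₅₇) with
`(p = 5 ∨ p = 7) ↦ p = 3`, VERBATIM otherwise:

  for a globally minimal CM curve `W/ℚ` of analytic rank one with `3` inert in the CM field and bad
  at `3`, and a lattice-optimal `X₀(N_W)`-parametrisation datum `D` (`Λ_W ⊆ c·Λ_f`), `3 ∤ c(D)`.

Width seat `bsd-wall-cm-bed-w2` g7 (cell `pub/bsd-wall`, explicit-unit). THEOREMS ONLY (no definition,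
no named fact, no `sorry`); the printed inputs are DISPLAYED hypotheses (`hM` Mazur 1978 Cor. 4.1,
`hAU` Abbes–Ullmo 1996 Thm. A, `hC2` Česnavičius 2018 Thm. 1.2 at `2 ∥ N`, `hnf` modularity as the
existence of a newform — the four by-name children `MazurManinOdd`, `AbbesUllmoManinGood`,
`CesnaviciusManinTwo`, `ModularityNewformExists` of BED's R₅₇ split, rev 4). This file is the `p = 3` twin
of the lane-2 alt-closer `Summits/BirchSwinnertonDyer/Rank1Residual/WAll/AltClosersManinCells.lean`
(`p ∈ {5, 7}`) and the QUARTIC SHARPENING of the lead's `…InertBadAtThreeBedManinIstar.lean` (p616527: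
the `I₀*` cell by signed type + the coarse off-`I₀*` residual), which it imports:

* §1 `kodairaSymbolAt_cases_of_cmInert_of_not_good_three` — **for a CM curve with `3` inert in the CM
  field and bad at `3`, the Kodaira type at the place of `ℤ` under `3` is `Iₙ*`, or `j = 1728` and the
  type is `III` or `III*`**: x1b's classification at `3`
  (`X12.hasGoodReductionAt_or_kodairaSymbolAt_of_hasCM_three`: `K ≠ ℚ(√−3)` ⟹ good, or `j = 1728` and
  `III / I₀* / III*`, or `j ∉ {0, 1728}` and `I₀*`), transported to the place of `ℤ`. (`j = 0` is
  CM-RAMIFIED at `3`, outside the crux.)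
* §1 `not_hasSignedLocalType_IstarZero_iff_quartic` — on the crux's locus (CM, `3` inert, bad at `3`):
  **NOT of signed local type `(3, I₀*)` (`X12.O10.HasSignedLocalType`, rung K8's child-19657 vocabulary)
  ⟺ `j = 1728` and Kodaira `III` or `III*` at the place of `ℤ` under `3`**.
* §2 `not_dvd_c_of_cmInert_three_of_j_ne_1728` — **the CLOSED HALF per curve: `j ≠ 1728 ⟹ 3 ∤ c(D)`**
  for the lattice-optimal datum, modulo `hM hAU hC2 hnf`: such a curve is of type `Iₙ*` at `3`, and
  `WAll.maninDatum_of_kodairaSymbolAt_eq_Istar` (the tree theorem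
  `ModularForms.not_dvd_maninConstant_of_kodairaSymbolAt_eq_Istar`: the `p*`-twist of a type-`I₀*` curve
  is good at `p`, Stevens 1989 Lemmas (5.2)/(5.4) PROVED in the tree — valid at EVERY odd prime) applies.
  (The `Iₙ*` cell BY SIGNED TYPE is the lead's `…BedManinIstar.not_dvd_c_of_hasSignedLocalType_Istar`,
  p616527 — imported, not restated.)
* §3 `maninAtThree_of_facts_of_quarticResidual` — **the stub statement `ManinAtThree` (body VERBATIM)
  ⟸ `hM`, `hAU`, `hC2`, `hnf` + the QUARTIC RESIDUAL at `3`**: the stub's own shape with the extra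
  hypothesis `W.j = 1728 ∧ (type III ∨ type III*)` at the place `v` of `ℤ` under `p = 3` (the curves
  `y² = x³ + Ax`, `ord₃ A` odd; semistability defect `e = 4`; potentially supersingular since
  `3 ≡ 3 (mod 4)`); `quarticResidual_of_maninAtThree` is the converse and
  `maninAtThree_iff_quarticResidual` the exactness — the weakest statement the line may register as its
  Manin stub at `3` without changing what it closes.
* §4 `offIstarResidual_iff_quarticResidual` (with both directions named) — the lead's OFF-`I₀*` residual
  of `…BedManinIstar.maninAtThree_of_facts_of_offIstarResidual` (the stub under
  `¬ HasSignedLocalType W p (I₀*)`, child 19657's vocabulary) ⟺ the QUARTIC residual, unconditionally —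
  so the Manin residual of `bed_at_three` lives on EXACTLY 19657's corner (census of record: 97 = 48
  `III` + 49 `III*` O10 classes `N < 5·10⁵`, x1b `LOCDIV-3.tsv`; no class-level source: Edixhoven 1991
  Thm. 3 needs `p > 7`, Mazur 1978 needs `9 ∤ N`, Česnavičius–Neururer–Saha 2024 Thm. 1.2 reads
  `val₃ c ≤ val₃ deg φ` per pair only; Cremona's `c = 1` for `N ≤ 5·10⁵` is per curve).

HONEST STATUS: `stub_maninAtThree` is NOT closed; it is REDUCED to four printed inputs by name and one
residual that is a sub-case of Manin's conjecture, open in print. 19225 stays open (heart). BSD is not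
proved by any of this.

References: [cite: EdixhovenManin1991, §1 and Thm. 3]; [cite: Stevens1989, Lemmas (5.2), (5.4)];
[cite: Mazur1978, Cor. 4.1]; [cite: Cesnavicius2018, Thm. 1.2]; [cite: SilvermanATAEC1994, IV.9.4
Table 4.1]; [cite: SilvermanAEC2009, X.5 Prop. 5.4]; `WAll/AltClosersManinCells.lean`;
`X12/InertBadLocalTypesThree.lean`; `Cruxes/InertBadAtThree/Lines/bed_at_three.{lean,md}`.
-/

set_option autoImplicit false
set_option linter.dupNamespace false

noncomputable section

open scoped Classical NumberField

open WeierstrassCurve NumberField IsDedekindDomain IsDedekindDomain.HeightOneSpectrum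
  Rat.HeightOneSpectrum Literature.NumberTheory.DiophantineGeometry
  Literature.NumberTheory.EllipticCurves Literature.NumberTheory.EllipticCurves.Rank1Residual
  Literature.NumberTheory.EllipticCurves.ModularForms

namespace Summit.BirchSwinnertonDyer.BirchSwinnertonDyer.Theorems.InertBadSignedBranchesInertBadAtThreeManinCells

open Summit.BirchSwinnertonDyer.Rank1Residual
open Summit.BirchSwinnertonDyer.Rank1Residual.X12.O10 (HasSignedLocalType)
open Summit.BirchSwinnertonDyer.BirchSwinnertonDyer.Theorems.InertBadSignedBranchesInertBadAtThreeBedManinIstar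
  (kodairaSymbolAt_int_eq_ringOfIntegers not_dvd_c_of_hasSignedLocalType_Istar)

/-! ## §1 The CM inert-bad Kodaira types at `3` -/

/-- **The local types of a CM curve at an inert bad `3`.** For `W/ℚ` with CM, `p = 3` inert in the CM
field (so `K ≠ ℚ(√−3)`, `j ≠ 0`) and `W` bad at `3`, at the place `v` of `ℤ` under `3`: the Kodaira type
is `Iₙ*` (in fact `I₀*`: every CM `j ≠ 0`, the quadratic twists), or `j = 1728` and the type is `III` or
`III*` (the quartic twists `y² = x³ + Ax`, `ord₃ A ∈ {1, 3}`). From x1b's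
`X12.hasGoodReductionAt_or_kodairaSymbolAt_of_hasCM_three`, transported to the place of `ℤ`.
[cite: SilvermanATAEC1994, IV.9.4, Table 4.1 and App. A §3] [cite: SilvermanAEC2009, X.5 Prop. 5.4] -/
theorem kodairaSymbolAt_cases_of_cmInert_of_not_good_three (W : WeierstrassCurve ℚ)
    [W.IsElliptic] (p : ℕ) [hp : Fact p.Prime] (hCM : W.HasCM) (hin : CMInert W p)
    (hbad : ¬ Good W p) (h3 : p = 3) (v : HeightOneSpectrum ℤ) (hv : natGenerator v = p) :
    (∃ n : ℕ, W.kodairaSymbolAt v = .Istar n) ∨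
      (W.j = 1728 ∧ (W.kodairaSymbolAt v = .III ∨ W.kodairaSymbolAt v = .IIIstar)) := by
  -- the place of `𝓞 ℚ` under `p`, where the X12 classification is stated
  set v' : HeightOneSpectrum (𝓞 ℚ) := (primesEquiv (R := 𝓞 ℚ)).symm ⟨p, hp.out⟩ with hv'def
  have hv' : natGenerator v' = p :=
    congrArg Subtype.val ((primesEquiv (R := 𝓞 ℚ)).apply_symm_apply ⟨p, hp.out⟩)
  have hbad' : ¬ W.HasGoodReductionAt v' :=
    fun h ↦ hbad ((X12.good_iff_hasGoodReductionAt W p v' hv').mpr h)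
  have hbr : W.kodairaSymbolAt v = W.kodairaSymbolAt v' :=
    kodairaSymbolAt_int_eq_ringOfIntegers W v v' (hv.trans hv'.symm)
  rw [hbr]
  subst h3
  rcases X12.hasGoodReductionAt_or_kodairaSymbolAt_of_hasCM_three W hCM v' hv' hin.1 with
    h | ⟨hj, hk⟩ | ⟨-, -, hk⟩
  · exact absurd h hbad'
  · rcases hk with h | h | h
    · exact Or.inr ⟨hj, Or.inl h⟩
    · exact Or.inl ⟨0, h⟩
    · exact Or.inr ⟨hj, Or.inr h⟩
  · exact Or.inl ⟨0, hk⟩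

/-- On the crux's locus the two currencies of the residual agree: **NOT of signed local type
`(3, I₀*)` ⟺ `j = 1728` and Kodaira `III` or `III*` at the place of `ℤ` under `3`** (for a CM curve,
`3` inert, bad at `3`). [cite: SilvermanAEC2009, X.5 Prop. 5.4] -/
theorem not_hasSignedLocalType_IstarZero_iff_quartic (W : WeierstrassCurve ℚ) [W.IsElliptic]
    (p : ℕ) [hp : Fact p.Prime] (hCM : W.HasCM) (hin : CMInert W p) (hbad : ¬ Good W p)
    (h3 : p = 3) (v : HeightOneSpectrum ℤ) (hv : natGenerator v = p) :
    ¬ HasSignedLocalType W p (.Istar 0) ↔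
      (W.j = 1728 ∧ (W.kodairaSymbolAt v = .III ∨ W.kodairaSymbolAt v = .IIIstar)) := by
  have key : ∀ v' : HeightOneSpectrum (𝓞 ℚ), natGenerator v' = p →
      W.kodairaSymbolAt v' = W.kodairaSymbolAt v :=
    fun v' hv' ↦ (kodairaSymbolAt_int_eq_ringOfIntegers W v v' (hv.trans hv'.symm)).symm
  set v₀ : HeightOneSpectrum (𝓞 ℚ) := (primesEquiv (R := 𝓞 ℚ)).symm ⟨p, hp.out⟩ with hv₀def
  have hv₀ : natGenerator v₀ = p :=
    congrArg Subtype.val ((primesEquiv (R := 𝓞 ℚ)).apply_symm_apply ⟨p, hp.out⟩)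
  constructor
  · intro hT
    rcases kodairaSymbolAt_cases_of_cmInert_of_not_good_three W p hCM hin hbad h3 v hv with
      ⟨n, hK⟩ | hres
    · -- type `Iₙ*`: by the classification at `3` it is `I₀*`, contradicting `hT`
      exfalso
      have hbad' : ¬ W.HasGoodReductionAt v₀ :=
        fun h ↦ hbad ((X12.good_iff_hasGoodReductionAt W p v₀ hv₀).mpr h)
      have h0 : W.kodairaSymbolAt v = .Istar 0 := by
        rw [← key v₀ hv₀]
        subst h3
        rcases X12.hasGoodReductionAt_or_kodairaSymbolAt_of_hasCM_three W hCM v₀ hv₀ hin.1 with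
          h | ⟨-, hk⟩ | ⟨-, -, hk⟩
        · exact absurd h hbad'
        · rcases hk with h | h | h
          · exact absurd ((key v₀ hv₀).symm.trans h) (by rw [hK]; simp)
          · exact h
          · exact absurd ((key v₀ hv₀).symm.trans h) (by rw [hK]; simp)
        · exact hk
      exact hT ⟨hCM, hin, hbad, fun v' hv' ↦ (key v' hv').trans h0⟩
    · exact hres
  · rintro ⟨-, hk⟩ ⟨-, -, -, hT⟩
    have h0 : W.kodairaSymbolAt v = .Istar 0 := (key v₀ hv₀).symm.trans (hT v₀ hv₀)
    rcases hk with h | h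
    · rw [h0] at h; simp at h
    · rw [h0] at h; simp at h

/-! ## §2 The closed half per curve: every CM `j ≠ 1728` -/

/-- **The closed half per curve: `j ≠ 1728 ⟹ 3 ∤ c(D)`** for a CM curve with `3` inert in the CM field
and bad at `3`, and a lattice-optimal datum `D` (mod `hM`, `hAU`, `hC2`, `hnf`): such a curve is of type
`I₀*` at `3` (a quadratic twist of a model good at `3`; this covers every CM `j ∉ {0, 1728}` — `j = 0`
is CM-ramified at `3`), so the lane-2 theorem `WAll.maninDatum_of_kodairaSymbolAt_eq_Istar` (hypothesis
only `p ≠ 2`) applies. The `j = 1728` curves of type `I₀*` (`y² = x³ + Ax`, `ord₃ A = 2`) are covered by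
the lead's `InertBadSignedBranchesInertBadAtThreeBedManinIstar.not_dvd_c_of_hasSignedLocalType_Istar`.
[cite: EdixhovenManin1991, §1 (typescript L96–101)] [cite: Stevens1989, Lemmas (5.2), (5.4)]
[cite: Mazur1978, Cor. 4.1] [cite: Cesnavicius2018, Thm. 1.2] -/
theorem not_dvd_c_of_cmInert_three_of_j_ne_1728
    (hM : mazur_not_dvd_maninConstant_of_odd)
    (hAU : abbesUllmo_not_dvd_maninConstant_of_not_dvd_level)
    (hC2 : cesnavicius_not_two_dvd_maninConstant_of_two_dvd_level)
    (hnf : exists_isNewformOf)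
    (W : WeierstrassCurve ℚ) [W.IsElliptic] [W.IsGloballyMinimal] {N : ℕ} [NeZero N]
    (D : ModularParametrizationData W N)
    (hopt : ∀ z ∈ D.L.lattice, ∃ w ∈ periodLattice D.f, z = D.c * w)
    (p : ℕ) [hp : Fact p.Prime] (hCM : W.HasCM) (h3 : p = 3) (hin : CMInert W p) (hbad : ¬ Good W p)
    (hj : W.j ≠ 1728) : ¬ (p : ℤ) ∣ D.c := by
  set v : HeightOneSpectrum ℤ := (primesEquiv (R := ℤ)).symm ⟨p, hp.out⟩ with hvdef
  have hv : natGenerator v = p :=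
    congrArg Subtype.val ((primesEquiv (R := ℤ)).apply_symm_apply ⟨p, hp.out⟩)
  rcases kodairaSymbolAt_cases_of_cmInert_of_not_good_three W p hCM hin hbad h3 v hv with
    ⟨n, hK⟩ | ⟨hj', -⟩
  · exact WAll.maninDatum_of_kodairaSymbolAt_eq_Istar hM hAU hC2 hnf W D hopt p (by omega) v hv hK
  · exact absurd hj' hj

/-! ## §3 The stub `ManinAtThree` from the four facts and the quartic residual; exactness -/

/-- **Line `bed_at_three`'s stub statement `ManinAtThree` (body VERBATIM) from four named facts and its
QUARTIC RESIDUAL.** The residual is the stub's own statement restricted to the cell of semistability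
defect `e = 4`: `j = 1728`, Kodaira type `III` or `III*` at the place `v` of `ℤ` under `p = 3`; the
`Iₙ*` cell (every CM `j ≠ 0`, the quadratic twists) is discharged by
`WAll.maninDatum_of_kodairaSymbolAt_eq_Istar`. The four facts are the named inputs of the tree's
semistable Manin theorem (`hM` Mazur 1978 Cor. 4.1, `hAU` Abbes–Ullmo 1996 Thm. A, `hC2` Česnavičius
2018 Thm. 1.2 at `2 ∥ N`) and modularity (`hnf`). [cite: EdixhovenManin1991, §1 and Thm. 3]
[cite: Stevens1989, Lemmas (5.2), (5.4)] [cite: Mazur1978, Cor. 4.1] [cite: Cesnavicius2018, Thm. 1.2] -/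
theorem maninAtThree_of_facts_of_quarticResidual
    (hM : mazur_not_dvd_maninConstant_of_odd)
    (hAU : abbesUllmo_not_dvd_maninConstant_of_not_dvd_level)
    (hC2 : cesnavicius_not_two_dvd_maninConstant_of_two_dvd_level)
    (hnf : exists_isNewformOf)
    (hRes : ∀ (W : WeierstrassCurve ℚ) [W.IsElliptic] [W.IsGloballyMinimal]
      [NeZero (W.conductorNorm ℤ)] (p : ℕ) [Fact p.Prime]
      (D : ModularParametrizationData W (W.conductorNorm ℤ)) (v : HeightOneSpectrum ℤ),
      natGenerator v = p → W.HasCM → W.analyticRank = 1 → p = 3 → CMInert W p →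
      ¬ Good W p → (∀ z ∈ D.L.lattice, ∃ w ∈ periodLattice D.f, z = D.c * w) →
      (W.j = 1728 ∧ (W.kodairaSymbolAt v = .III ∨ W.kodairaSymbolAt v = .IIIstar)) →
      ¬ (p : ℤ) ∣ D.c) :
    ∀ (W : WeierstrassCurve ℚ) [W.IsElliptic] [W.IsGloballyMinimal] [NeZero (W.conductorNorm ℤ)]
      (p : ℕ) [Fact p.Prime]
      (D : Literature.NumberTheory.EllipticCurves.ModularForms.ModularParametrizationData W
        (W.conductorNorm ℤ)),
      W.HasCM → W.analyticRank = 1 → p = 3 →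
      Literature.NumberTheory.EllipticCurves.Rank1Residual.CMInert W p →
      ¬ Literature.NumberTheory.EllipticCurves.Rank1Residual.Good W p →
      (∀ z ∈ D.L.lattice, ∃ w ∈ Literature.NumberTheory.EllipticCurves.ModularForms.periodLattice D.f,
        z = D.c * w) → ¬ (p : ℤ) ∣ D.c := by
  intro W _ _ _ p hp D hCM hr h3 hin hbad hopt
  set v : HeightOneSpectrum ℤ := (primesEquiv (R := ℤ)).symm ⟨p, hp.out⟩ with hvdef
  have hv : natGenerator v = p :=
    congrArg Subtype.val ((primesEquiv (R := ℤ)).apply_symm_apply ⟨p, hp.out⟩)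
  rcases kodairaSymbolAt_cases_of_cmInert_of_not_good_three W p hCM hin hbad h3 v hv with
    ⟨n, hK⟩ | hres
  · exact WAll.maninDatum_of_kodairaSymbolAt_eq_Istar hM hAU hC2 hnf W D hopt p (by omega) v hv hK
  · exact hRes W p D v hv hCM hr h3 hin hbad hopt hres

/-- **Converse: the stub statement implies its quartic residual** (drop the extra hypotheses).
Bookkeeping. [folklore] -/
theorem quarticResidual_of_maninAtThree
    (h : ∀ (W : WeierstrassCurve ℚ) [W.IsElliptic] [W.IsGloballyMinimal] [NeZero (W.conductorNorm ℤ)]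
      (p : ℕ) [Fact p.Prime] (D : ModularParametrizationData W (W.conductorNorm ℤ)),
      W.HasCM → W.analyticRank = 1 → p = 3 → CMInert W p → ¬ Good W p →
      (∀ z ∈ D.L.lattice, ∃ w ∈ periodLattice D.f, z = D.c * w) → ¬ (p : ℤ) ∣ D.c) :
    ∀ (W : WeierstrassCurve ℚ) [W.IsElliptic] [W.IsGloballyMinimal]
      [NeZero (W.conductorNorm ℤ)] (p : ℕ) [Fact p.Prime]
      (D : ModularParametrizationData W (W.conductorNorm ℤ)) (v : HeightOneSpectrum ℤ),
      natGenerator v = p → W.HasCM → W.analyticRank = 1 → p = 3 → CMInert W p →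
      ¬ Good W p → (∀ z ∈ D.L.lattice, ∃ w ∈ periodLattice D.f, z = D.c * w) →
      (W.j = 1728 ∧ (W.kodairaSymbolAt v = .III ∨ W.kodairaSymbolAt v = .IIIstar)) →
      ¬ (p : ℤ) ∣ D.c :=
  fun W _ _ _ p _ D _ _ hCM hr h3 hin hbad hopt _ ↦ h W p D hCM hr h3 hin hbad hopt

/-- **Exactness: modulo `hM`, `hAU`, `hC2`, `hnf`, the stub `ManinAtThree` ⟺ its quartic residual** —
the weakest statement line `bed_at_three` may register as its Manin stub at `3` without changing what
it closes. [folklore] -/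
theorem maninAtThree_iff_quarticResidual
    (hM : mazur_not_dvd_maninConstant_of_odd)
    (hAU : abbesUllmo_not_dvd_maninConstant_of_not_dvd_level)
    (hC2 : cesnavicius_not_two_dvd_maninConstant_of_two_dvd_level)
    (hnf : exists_isNewformOf) :
    (∀ (W : WeierstrassCurve ℚ) [W.IsElliptic] [W.IsGloballyMinimal] [NeZero (W.conductorNorm ℤ)]
      (p : ℕ) [Fact p.Prime] (D : ModularParametrizationData W (W.conductorNorm ℤ)),
      W.HasCM → W.analyticRank = 1 → p = 3 → CMInert W p → ¬ Good W p →
      (∀ z ∈ D.L.lattice, ∃ w ∈ periodLattice D.f, z = D.c * w) → ¬ (p : ℤ) ∣ D.c) ↔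
    (∀ (W : WeierstrassCurve ℚ) [W.IsElliptic] [W.IsGloballyMinimal]
      [NeZero (W.conductorNorm ℤ)] (p : ℕ) [Fact p.Prime]
      (D : ModularParametrizationData W (W.conductorNorm ℤ)) (v : HeightOneSpectrum ℤ),
      natGenerator v = p → W.HasCM → W.analyticRank = 1 → p = 3 → CMInert W p →
      ¬ Good W p → (∀ z ∈ D.L.lattice, ∃ w ∈ periodLattice D.f, z = D.c * w) →
      (W.j = 1728 ∧ (W.kodairaSymbolAt v = .III ∨ W.kodairaSymbolAt v = .IIIstar)) →
      ¬ (p : ℤ) ∣ D.c) :=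
  ⟨quarticResidual_of_maninAtThree, maninAtThree_of_facts_of_quarticResidual hM hAU hC2 hnf⟩

/-! ## §4 The residual in rung K8's signed-local-type currency = the lead's off-`I₀*` residual -/

/-- **The lead's OFF-`I₀*` residual ⟹ the quartic residual.** The hypothesis shape of
`InertBadSignedBranchesInertBadAtThreeBedManinIstar.maninAtThree_of_facts_of_offIstarResidual` (the stub
under `¬ HasSignedLocalType W p (I₀*)`, rung K8's HELD child `InertBadAtThreeOffIstarZero`'s vocabulary,
stmt-BirchSwinnertonDyer-19657) implies the stub under `j = 1728 ∧ type III/III*`: on the crux's locus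
the two cells coincide (`not_hasSignedLocalType_IstarZero_iff_quartic`). Unconditional. [folklore] -/
theorem quarticResidual_of_offIstarResidual
    (h : ∀ (W : WeierstrassCurve ℚ) [W.IsElliptic] [W.IsGloballyMinimal] [NeZero (W.conductorNorm ℤ)]
      (p : ℕ) [Fact p.Prime] (D : ModularParametrizationData W (W.conductorNorm ℤ)),
      W.HasCM → W.analyticRank = 1 → p = 3 → CMInert W p → ¬ Good W p →
      ¬ HasSignedLocalType W p (.Istar 0) →
      (∀ z ∈ D.L.lattice, ∃ w ∈ periodLattice D.f, z = D.c * w) → ¬ (p : ℤ) ∣ D.c) :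
    ∀ (W : WeierstrassCurve ℚ) [W.IsElliptic] [W.IsGloballyMinimal]
      [NeZero (W.conductorNorm ℤ)] (p : ℕ) [Fact p.Prime]
      (D : ModularParametrizationData W (W.conductorNorm ℤ)) (v : HeightOneSpectrum ℤ),
      natGenerator v = p → W.HasCM → W.analyticRank = 1 → p = 3 → CMInert W p →
      ¬ Good W p → (∀ z ∈ D.L.lattice, ∃ w ∈ periodLattice D.f, z = D.c * w) →
      (W.j = 1728 ∧ (W.kodairaSymbolAt v = .III ∨ W.kodairaSymbolAt v = .IIIstar)) →
      ¬ (p : ℤ) ∣ D.c :=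
  fun W _ _ _ p _ D v hv hCM hr h3 hin hbad hopt hres ↦
    h W p D hCM hr h3 hin hbad
      ((not_hasSignedLocalType_IstarZero_iff_quartic W p hCM hin hbad h3 v hv).mpr hres) hopt

/-- **The quartic residual ⟹ the lead's OFF-`I₀*` residual** (the other direction; the place `v` of `ℤ`
under `p` is `(primesEquiv (R := ℤ)).symm ⟨p, _⟩`). Unconditional. [folklore] -/
theorem offIstarResidual_of_quarticResidual
    (h : ∀ (W : WeierstrassCurve ℚ) [W.IsElliptic] [W.IsGloballyMinimal]
      [NeZero (W.conductorNorm ℤ)] (p : ℕ) [Fact p.Prime]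
      (D : ModularParametrizationData W (W.conductorNorm ℤ)) (v : HeightOneSpectrum ℤ),
      natGenerator v = p → W.HasCM → W.analyticRank = 1 → p = 3 → CMInert W p →
      ¬ Good W p → (∀ z ∈ D.L.lattice, ∃ w ∈ periodLattice D.f, z = D.c * w) →
      (W.j = 1728 ∧ (W.kodairaSymbolAt v = .III ∨ W.kodairaSymbolAt v = .IIIstar)) →
      ¬ (p : ℤ) ∣ D.c) :
    ∀ (W : WeierstrassCurve ℚ) [W.IsElliptic] [W.IsGloballyMinimal] [NeZero (W.conductorNorm ℤ)]
      (p : ℕ) [Fact p.Prime] (D : ModularParametrizationData W (W.conductorNorm ℤ)),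
      W.HasCM → W.analyticRank = 1 → p = 3 → CMInert W p → ¬ Good W p →
      ¬ HasSignedLocalType W p (.Istar 0) →
      (∀ z ∈ D.L.lattice, ∃ w ∈ periodLattice D.f, z = D.c * w) → ¬ (p : ℤ) ∣ D.c := by
  intro W _ _ _ p hp D hCM hr h3 hin hbad hT hopt
  set v : HeightOneSpectrum ℤ := (primesEquiv (R := ℤ)).symm ⟨p, hp.out⟩ with hvdef
  have hv : natGenerator v = p :=
    congrArg Subtype.val ((primesEquiv (R := ℤ)).apply_symm_apply ⟨p, hp.out⟩)
  exact h W p D v hv hCM hr h3 hin hbad hopt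
    ((not_hasSignedLocalType_IstarZero_iff_quartic W p hCM hin hbad h3 v hv).mp hT)

/-- **The two residual texts of stub R₃ are EQUIVALENT** (unconditionally, no printed fact): the lead's
off-`I₀*` residual (rung K8's child-19657 vocabulary) ⟺ the quartic residual (`j = 1728`, Kodaira
`III / III*` at the place of `ℤ` under `3` — BED's R₅₇ˢᶜ vocabulary). So the Manin residual of line
`bed_at_three` is Manin's conjecture at `3` for the lattice-optimal curves of EXACTLY 19657's corner
(census of record: 97 = 48 `III` + 49 `III*` O10 classes with `N < 5·10⁵`). [folklore] -/
theorem offIstarResidual_iff_quarticResidual :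
    (∀ (W : WeierstrassCurve ℚ) [W.IsElliptic] [W.IsGloballyMinimal] [NeZero (W.conductorNorm ℤ)]
      (p : ℕ) [Fact p.Prime] (D : ModularParametrizationData W (W.conductorNorm ℤ)),
      W.HasCM → W.analyticRank = 1 → p = 3 → CMInert W p → ¬ Good W p →
      ¬ HasSignedLocalType W p (.Istar 0) →
      (∀ z ∈ D.L.lattice, ∃ w ∈ periodLattice D.f, z = D.c * w) → ¬ (p : ℤ) ∣ D.c) ↔
    (∀ (W : WeierstrassCurve ℚ) [W.IsElliptic] [W.IsGloballyMinimal]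
      [NeZero (W.conductorNorm ℤ)] (p : ℕ) [Fact p.Prime]
      (D : ModularParametrizationData W (W.conductorNorm ℤ)) (v : HeightOneSpectrum ℤ),
      natGenerator v = p → W.HasCM → W.analyticRank = 1 → p = 3 → CMInert W p →
      ¬ Good W p → (∀ z ∈ D.L.lattice, ∃ w ∈ periodLattice D.f, z = D.c * w) →
      (W.j = 1728 ∧ (W.kodairaSymbolAt v = .III ∨ W.kodairaSymbolAt v = .IIIstar)) →
      ¬ (p : ℤ) ∣ D.c) :=
  ⟨quarticResidual_of_offIstarResidual, offIstarResidual_of_quarticResidual⟩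

end Summit.BirchSwinnertonDyer.BirchSwinnertonDyer.Theorems.InertBadSignedBranchesInertBadAtThreeManinCells

end
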